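import Mathlib
import Summits.Ventures.PercRepro2.CoinLsmCoreAlg
import Summits.Ventures.PercRepro2.CoinLsmCoreDefs
import Summits.Ventures.PercRepro2.CoinLsmCoreMass
import Summits.Ventures.PercRepro2.CoinLsmCore
import Summits.Ventures.PercRepro2.CoinTreeCore

/-!
# The tree-core theorem with the tail BETWEEN the root and a marker — an instantiation check
(blind cell PercRepro2, night-2 g7; NIGHT2-DARC.md §30.10, §30.12)

A concrete coin system on `Fin 9` (s = 0, u = 1, a = 2, b = 3, w = 4, v₀ = 5, v₁ = 6, v₂ = 7,
t = 8): the out-tree core s → u → a, s → b (the tail `u` is the PARENT of the marker `a`, so `u` and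
`a` are correlated through the core), the entries a → v₁, b → v₂, a → w, b → w, and the diamond
head w → v₀ → {v₁, v₂} → t — twelve single-arc coins, all random.  `TreeCore` is discharged by
`decide` (rank: `u ↦ 1`, `a ↦ 2`, `b ↦ 1`), and `darc_of_treeCore` gives row 2′DARC at the arc
`u → w` for every probability vector under the two cell-mass positivity hypotheses.
-/

namespace Summit.Ventures.PercRepro2.Coin

namespace TreeCoreExample

open Classical

/-- The twelve coins of the example. -/
def arcsEx : Fin 12 → Finset (Fin 9 × Fin 9)
  | 0 => {(0, 1)}   -- c u : s → u
  | 1 => {(1, 2)}   -- c a : u → a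
  | 2 => {(0, 3)}   -- c b : s → b
  | 3 => {(2, 6)}   -- a → v₁
  | 4 => {(3, 7)}   -- b → v₂
  | 5 => {(2, 4)}   -- a → w
  | 6 => {(3, 4)}   -- b → w
  | 7 => {(4, 5)}   -- arm w → v₀
  | 8 => {(5, 6)}   -- v₀ → v₁
  | 9 => {(5, 7)}   -- v₀ → v₂
  | 10 => {(6, 8)}  -- v₁ → t
  | 11 => {(7, 8)}  -- v₂ → t

/-- The tree coins: `c u = 0`, `c a = 1`, `c b = 2`. -/
def cEx : Fin 9 → Fin 12
  | 1 => 0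
  | 2 => 1
  | 3 => 2
  | _ => 0

/-- The parent map: `par u = s`, `par a = u`, `par b = s`. -/
def parEx : Fin 9 → Fin 9
  | 1 => 0
  | 2 => 1
  | 3 => 0
  | _ => 0

/-- The rank: `u ↦ 1`, `a ↦ 2`, `b ↦ 1`. -/
def rkEx : Fin 9 → ℕ
  | 1 => 1
  | 2 => 2
  | 3 => 1
  | _ => 0

/-- Every coin is a single arc, so `SameEnds` holds. -/
lemma sameEnds_ex : SameEnds arcsEx := by
  intro e xy hxy x'y' hx'y'
  fin_cases e <;> simp [arcsEx] at hxy hx'y' <;> subst hxy <;> subst hx'y' <;>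
    exact ⟨Or.inl rfl, Or.inr rfl⟩

/-- `{u, a, b}` is an out-tree core of `s`. -/
lemma treeCore_ex : TreeCore arcsEx 0 {1, 2, 3} cEx parEx rkEx where
  tree := by decide
  par_mem := by decide
  rank := by decide
  into_C := by decide
  into_s := by decide
  s_notin := by decide

/-- **Row 2′DARC at the arc `u → w` with `u` the parent of the marker `a`, for every probability
vector** (positivity of the two cell masses assumed). -/
theorem darc_treeCore_example {R : Type*} [Field R] [LinearOrder R] [IsStrictOrderedRing R]
    (p : Fin 12 → R) (hp : IsProbVec p)
    (hM₀ : 0 < ∑ W ∈ ({1, 2, 3} : Finset (Fin 9)).powerset,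
      prob p (coreLevel arcsEx 0 {1, 2, 3} W) * notMemWt 1 W *
        prob p (coreAvoidEvent arcsEx 0 8 {1, 2, 3} W))
    (hM' : 0 < ∑ W ∈ ({1, 2, 3} : Finset (Fin 9)).powerset,
      prob p (coreLevel arcsEx 0 {1, 2, 3} W) * memWt 1 W *
        prob p (coreAvoidEvent arcsEx 0 8 {1, 2, 3} (insert 4 W))) :
    DARC p arcsEx 0 {8} 2 3 1 4 :=
  darc_of_treeCore p hp sameEnds_ex treeCore_ex (by decide) (by decide) (by decide) (by decide)
    (by decide) (by decide) (by decide) hM₀ hM'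

end TreeCoreExample

end Summit.Ventures.PercRepro2.Coin
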